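import Literature.AnabelianGeometry.EtaleTheta.Discharge.Sec5KummerOutTransport

/-!
# [EtTh] §5, Lemma 5.9 (iv) at the honest `K^×`-part — the Kummer-surjectivity input in its CONTINUOUS form (p. 273 / PDF p. 47; p. 332 / PDF p. 106)

Mochizuki, *The étale theta function …*, Publ. RIMS **45** (2009)
[cite: MochizukiEtTh2009, Def 2.13 (i) p.273 (PDF p.47); Lem 5.9 (iv) p.332 (PDF p.106)].  abc-iut cell, layer
L2; GAP-LEDGER row G-L2t11-2 (shape ruling of abc-iut-L2-lead 02:30:52Z); seat abc-iut-L6-t23 (gen 4), filed under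
the succession rule for the closed seat abc-iut-L2-t11 (gen 2).  PROOF-ONLY supplement (no `def`; nothing of
abc-iut-L2-t11's `Sec5KummerOutTransport.lean` edited): the three theorems `BiratAutAction.kummerOutReached_birat`,
`envIsoBiTheta_birat`, `frdIsMonoThetaEnv_birat` there take the Kummer-surjectivity input
`hKum : ∀ δ₀, IsEnvCocycle (δ₀ ∘ augY) → ∃ f a, …` for EVERY algebraic `μ_N`-valued 1-cocycle of `G_K`; print
(p.273: "`K^× ↠ (K^×)/(K^×)^N ⥲ H¹(G_K, μ_N)` — where the '`⥲`' is the Kummer map") means the CONTINUOUS `H¹`, and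
at a genuine `G_K` the algebraic form would be dischargeable only through «every finite-index subgroup of `G_K` is
open» (topological finite generation + Nikolov–Segal).  The consumer already HOLDS the continuity witness: an
element of abc-iut-L2-t2's `kummerOut` is `⟨δ, hδ, hc, _⟩` with `hc : shift hδ ∈ contMulAut`.  Here are the same
three theorems with the WEAKER input `hKumC : ∀ δ₀ hδ, CycEnvelope.shift hδ ∈ contMulAut T.env → ∃ f a, …`
(continuous cocycles only) — proofs verbatim those of abc-iut-L2-t11 with `hc` passed through; the eventual
discharge at the genuine data is then honest Kummer theory of the MLF `K` (Hilbert 90); `hKumC_of_hKum` records that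
the new theorems are at least as strong.  HONEST FRAMING: kernel-checked implications; nothing of [EtTh] is
asserted unconditionally; typed ≠ proved; no side is taken on anything downstream ([IUTchIII] Cor. 3.12).
-/

noncomputable section

namespace Literature.AnabelianGeometry.EtaleTheta

open CategoryTheory

universe w v v' u u'

namespace ThetaFrobenioid

variable {C : Type u} [Category.{v} C] {D : Type u'} [Category.{v'} D] {𝔉 : ThetaFrobenioid.{w} C D}

namespace BiratAutAction

variable (α : 𝔉.BiratAutAction)

section Transport

variable (hK : 𝔉.KxRootNModCyclotome) (H : 𝔉.Facts) (T : ThetaEnvData.{v} 𝔉.N) (ι : 𝔉.PiX ≃ₜ* T.PiX)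
  (m : 𝔉.muTorsion 𝔉.BN 𝔉.N ≃* T.mu) (hY : 𝔉.IdentifiesPiY T ι.toMulEquiv)
  (hχ : 𝔉.CyclotomicCharacterCompat T ι.toMulEquiv m)

/-- **`KummerOutReached` at `DK := kummerOut` from CONTINUOUS Kummer surjectivity**: as abc-iut-L2-t11's
`kummerOutReached_birat`, but the input `hKumC` is required only for cocycles whose shift is bi-continuous
(`shift hδ ∈ contMulAut`, i.e. `δ₀ ∘ augY` locally constant) — exactly the elements of `kummerOut` ("the image of
`K^× ↠ (K^×)/(K^×)^N ⥲ H¹(G_K, μ_N) → H¹(Π^tp_Y, μ_N) → Out(Π^tp_Y[μ_N])`", p.273, CONTINUOUS cohomology).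
[cite: MochizukiEtTh2009, Lem 5.9 (iv) p.332 (PDF p.106)] -/
theorem kummerOutReached_birat_of_continuous (h1 : 𝔉.SectionsFactor) (h3 : 𝔉.OuterActionLZ)
    (hsec : 𝔉.SgpCapSection) (hcs : 𝔉.SgpCupSection) (h8 : 𝔉.ConstantsEqNormalizer)
    (hKumC : ∀ (δ₀ : T.G → T.mu) (hδ : CycEnvelope.IsEnvCocycle T.augY T.chi (δ₀ ∘ T.augY)),
      CycEnvelope.shift hδ ∈ contMulAut T.env →
      ∃ (f : 𝔉.KxRootN) (a : T.mu), ∀ p : T.PiY,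
        δ₀ (T.augY p) = (α.kummerCocycleY hK f T ι.toMulEquiv m p)⁻¹ * CycEnvelope.coboundary T.augY T.chi a p) :
    𝔉.KummerOutReached H h1 h3 hsec hcs h8 (α.kummerOut hK) T ι m hY hχ := by
  rintro o ⟨δ₀, hδ, hc, rfl⟩
  obtain ⟨f, a, hfa⟩ := hKumC δ₀ hδ hc
  have hmem : α.kummerOutHom hK f ∈ (𝔉.frdBiThetaEnv h1 h3 hsec hcs h8 (α.kummerOut hK)).D :=
    Subgroup.subset_closure (Or.inr ⟨f, rfl⟩)
  have key := α.congr_kummerAutHom_eq_shift hK H T ι m hY hχ f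
  suffices heq : TopOut.mk T.env ⟨CycEnvelope.shift hδ, hc⟩ =
      TopOut.transport (𝔉.envContIso H T ι m hY hχ) (α.kummerOutHom hK f) by
    rw [heq]
    exact Subgroup.mem_map_of_mem _ hmem
  rw [kummerOutHom_apply]
  change TopOut.mk _ _ = TopOut.mk _ (conjContAut _ ⟨_, _⟩)
  refine QuotientGroup.eq.mpr ?_
  rw [Subgroup.mem_subgroupOf]
  refine ⟨CycEnvelope.inMu T.augY T.chi a⁻¹, ?_⟩
  apply MulEquiv.ext
  intro z
  rw [CycEnvelope.conj_inMu_eq_shift_coboundary]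
  change _ = (CycEnvelope.shift hδ).symm
    (MulAut.congr (𝔉.envContIso H T ι m hY hχ).toMulEquiv (α.kummerAutHom hK f) z)
  rw [key]
  ext
  · change z.left * CycEnvelope.coboundary T.augY T.chi a⁻¹ z.right =
      z.left * (α.kummerCocycleY hK f T ι.toMulEquiv m z.right)⁻¹ * ((δ₀ ∘ T.augY) z.right)⁻¹
    rw [Function.comp_apply, hfa z.right]
    simp only [CycEnvelope.coboundary, map_inv, mul_inv_rev, inv_inv]
    simp only [mul_assoc, mul_comm, mul_left_comm, mul_inv_cancel_left]
  · rfl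

end Transport

section Assembly

variable (hK : 𝔉.KxRootNModCyclotome) (H : 𝔉.Facts) (h1 : 𝔉.SectionsFactor) (h3 : 𝔉.OuterActionLZ)
  (hsec : 𝔉.SgpCapSection) (hcs : 𝔉.SgpCupSection) (h8 : 𝔉.ConstantsEqNormalizer)
  (T : ThetaEnvData.{v} 𝔉.N) (ι : 𝔉.PiX ≃ₜ* T.PiX) (m : 𝔉.muTorsion 𝔉.BN 𝔉.N ≃* T.mu)
  (hY : 𝔉.IdentifiesPiY T ι.toMulEquiv) (hYdd : 𝔉.IdentifiesPiYdd T ι.toMulEquiv)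
  (hχX : 𝔉.CyclotomicCharacterCompatX T ι.toMulEquiv m)

include hY hχX in
/-- **[EtTh] Lemma 5.9 (iv) at the honest `K^×`-part, CONTINUOUS Kummer input**: abc-iut-L2-t4's `EnvIsoBiTheta`
at `DK := kummerOut`, as abc-iut-L2-t11's `envIsoBiTheta_birat` with `hKum` weakened to `hKumC` (continuous cocycles
only).  [cite: MochizukiEtTh2009, Lem 5.9 (iv) p.332 (PDF p.106)] -/
theorem envIsoBiTheta_birat_of_continuous {η : T.PiYdd → T.mu} (hη : η ∈ T.thetaCocycles)
    (hcompat : 𝔉.ThetaSectionCompat H T ι.toMulEquiv m hYdd η)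
    (hinfl : ∀ f : 𝔉.KxRootN, ∃ δ₀ : T.G → T.mu, ∀ (y : 𝔉.PiX), y ∈ 𝔉.PiY →
      m (α.kummerCocycle hK f (𝔉.sgpCap (𝔉.ρ y))) = δ₀ (T.aug (ι y)))
    (hKumC : ∀ (δ₀ : T.G → T.mu) (hδ : CycEnvelope.IsEnvCocycle T.augY T.chi (δ₀ ∘ T.augY)),
      CycEnvelope.shift hδ ∈ contMulAut T.env →
      ∃ (f : 𝔉.KxRootN) (a : T.mu), ∀ p : T.PiY,
        δ₀ (T.augY p) = (α.kummerCocycleY hK f T ι.toMulEquiv m p)⁻¹ * CycEnvelope.coboundary T.augY T.chi a p) :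
    𝔉.EnvIsoBiTheta h1 h3 hsec hcs h8 (α.kummerOut hK) T ι :=
  𝔉.envIsoBiTheta_of H h1 h3 hsec hcs h8 (α.kummerOut hK) T ι m hY hYdd hχX hη hcompat
    (α.constOutTransported_birat hK H T ι m hY hχX.toY h8 hinfl)
    (α.kummerOutReached_birat_of_continuous hK H T ι m hY hχX.toY h1 h3 hsec hcs h8 hKumC)

include hY hχX in
/-- **Lemma 5.9 (iv) "In particular" at the honest `K^×`-part, CONTINUOUS Kummer input**: abc-iut-L2-t4's
`FrdIsMonoThetaEnv` at `DK := kummerOut` (the binder `hM` of the [IUTchII] Prop. 1.2 (ii) bridge), as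
abc-iut-L2-t11's `frdIsMonoThetaEnv_birat` with `hKumC`.  [cite: MochizukiEtTh2009, Lem 5.9 (iv) p.332 (PDF p.106)] -/
theorem frdIsMonoThetaEnv_birat_of_continuous {η : T.PiYdd → T.mu} (hη : η ∈ T.thetaCocycles)
    (hcompat : 𝔉.ThetaSectionCompat H T ι.toMulEquiv m hYdd η)
    (hinfl : ∀ f : 𝔉.KxRootN, ∃ δ₀ : T.G → T.mu, ∀ (y : 𝔉.PiX), y ∈ 𝔉.PiY →
      m (α.kummerCocycle hK f (𝔉.sgpCap (𝔉.ρ y))) = δ₀ (T.aug (ι y)))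
    (hKumC : ∀ (δ₀ : T.G → T.mu) (hδ : CycEnvelope.IsEnvCocycle T.augY T.chi (δ₀ ∘ T.augY)),
      CycEnvelope.shift hδ ∈ contMulAut T.env →
      ∃ (f : 𝔉.KxRootN) (a : T.mu), ∀ p : T.PiY,
        δ₀ (T.augY p) = (α.kummerCocycleY hK f T ι.toMulEquiv m p)⁻¹ * CycEnvelope.coboundary T.augY T.chi a p) :
    𝔉.FrdIsMonoThetaEnv h1 h3 hsec hcs h8 (α.kummerOut hK) T :=
  𝔉.frdIsMonoThetaEnv_of h1 h3 hsec hcs h8 (α.kummerOut hK) T ι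
    (α.envIsoBiTheta_birat_of_continuous hK H h1 h3 hsec hcs h8 T ι m hY hYdd hχX hη hcompat hinfl hKumC)

omit hY hχX in
/-- The algebraic input implies the continuous one (the `_of_continuous` theorems are at least as strong as
abc-iut-L2-t11's).  [cite: MochizukiEtTh2009, Lem 5.9 (iv) p.332 (PDF p.106)] -/
theorem hKumC_of_hKum
    (hKum : ∀ δ₀ : T.G → T.mu, CycEnvelope.IsEnvCocycle T.augY T.chi (δ₀ ∘ T.augY) →
      ∃ (f : 𝔉.KxRootN) (a : T.mu), ∀ p : T.PiY,
        δ₀ (T.augY p) = (α.kummerCocycleY hK f T ι.toMulEquiv m p)⁻¹ * CycEnvelope.coboundary T.augY T.chi a p) :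
    ∀ (δ₀ : T.G → T.mu) (hδ : CycEnvelope.IsEnvCocycle T.augY T.chi (δ₀ ∘ T.augY)),
      CycEnvelope.shift hδ ∈ contMulAut T.env →
      ∃ (f : 𝔉.KxRootN) (a : T.mu), ∀ p : T.PiY,
        δ₀ (T.augY p) = (α.kummerCocycleY hK f T ι.toMulEquiv m p)⁻¹ * CycEnvelope.coboundary T.augY T.chi a p :=
  fun δ₀ hδ _ => hKum δ₀ hδ

end Assembly

end BiratAutAction

end ThetaFrobenioid

end Literature.AnabelianGeometry.EtaleTheta

end
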